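import Literature.Analysis.FluidPDE.StokesMollified
import Literature.Analysis.FluidPDE.NSSuitableESSProofs
import HarnessLib

/-!
# The local energy equality of `L²_loc` distributional solutions of the forced Stokes system

Analysis/FluidPDE proof file (theorems only; no definitions, no named facts). For the linear
non-stationary Stokes system with a force,

  `∂ₜu - Δu + ∇p = f`, `div u = 0` in `𝒟'(Q)`, `Q ⊆ ℝ × E` open

(the tree's `IsDistributionalStokesSolutionOn Q f u p`, Seregin 2014, §4.6 (4.6.1)), every
solution in the *energy class* satisfies the **local energy equality**: if `u`, a weak spatial
gradient `∇u = G` of `u`, the pressure `p` and the force `f` are all square integrable on the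
compact subsets of `Q`, then for every test function `φ ∈ C_c^∞(Q)`

  `2 ∫∫_Q |∇u|² φ = ∫∫_Q ( |u|² (∂ₜφ + Δφ) + 2 p (u·∇φ) + 2 (f·u) φ )`

(`IsDistributionalStokesSolutionOn.local_energy_equality`). This is the linear case of
Caffarelli–Kohn–Nirenberg's local energy inequality (CKN 1982, §2, (2.5): "if `(u, p)` were a
smooth solution of (1.1), then (2.5) would hold with equality") — for the Stokes system there is
no cubic term, the formal computation "multiply by `uφ` and integrate by parts" is justified at
the `L²` level, and equality survives: the identity is obtained, as in the first paragraph of the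
proof of Thm. 1.4 of Escauriaza–Seregin–Šverák 2003 ("this can be verified with the help of usual
mollification"), by

1. localising to a bounded open neighbourhood `Q₀ ⋐ Q` of `supp φ` on which `u, G, p, f ∈ L²`
   and extending by zero (`Fluid.zeroExt`);
2. mollifying in space–time: by the tree's `StokesMollified`
   (`IsDistributionalStokesSolutionOn.mollified_momentum_vec`, `.divergence_mollified_eq_zero`) and
   `HasWeakSpatialGradientOn.fderiv_mollified`, the mollified triple `(Vₙ, Pₙ, Fₙ)` solves
   `∂ₜVₙ - ΔVₙ + ∇Pₙ = Fₙ`, `div Vₙ = 0`, `∇Vₙ = (∇u)ₙ` **pointwise** on `supp φ` once the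
   mollification radius is below the distance from `supp φ` to `∂Q₀`;
3. the classical identity for smooth solutions of the forced system
   (`local_energy_identity_smooth_stokes`, from the tree's slice identity
   `integral_two_mul_inner_eq_of_momentum` with `N = 0` and `W = ∂ₜV - F`, the fundamental theorem
   of calculus on time lines and Fubini);
4. passage to the limit `n → ∞`: `Vₙ → u`, `∇Vₙ → ∇u`, `Fₙ → f` in `L²(ℝ × E)` and, for the
   pressure term, `Pₙ → p` in `L^q`, `Vₙ → u` in `L^{q'}`
   (`FunctionSpaces.tendsto_eLpNorm_normed_convolution_sub_self`), every term of the identity being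
   a bounded weight against a bilinear expression in two convergent sequences of conjugate
   Lebesgue classes (`MollifiedLimits`).

Typical use (the reason this file exists): linearised or perturbed Navier–Stokes systems whose
lower-order terms are square integrable — e.g. the mollified Leray/Navier–Stokes schemes of Leray
1934 and of Bradshaw–Tsai 2017 (Lemma 2.6, proof of Thm. 2.4: "the approximating solutions all
satisfy the local energy equality"), differences of two local Leray solutions, the Stokes system
with `L²` right-hand side in ε-regularity theory — are distributional Stokes solutions with an
`L²_loc` force `f`, so their local energy (in)equalities are instances of this one.

## Main statements (all proved)

* `local_energy_identity_smooth_stokes` — the identity for smooth fields solving the forced system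
  pointwise on `{φ ≠ 0}`;
* `IsDistributionalStokesSolutionOn.local_energy_equality_holder` — the local energy
  **equality** for distributional solutions with `u`, a weak gradient `∇u` and `f` in `L²_loc(Q)`
  and the pressure term controlled by a Hölder pair: `p ∈ L^q_loc(Q)`, `u ∈ L^{q'}_loc(Q)`,
  `1/q + 1/q' = 1` (the setting of suitable weak solutions, `q = 3/2`, `q' = 3`, CKN 1982 (2.2);
  of Bradshaw–Tsai's approximants, `q = 5/3`, `q' = 5/2`);
* `IsDistributionalStokesSolutionOn.local_energy_equality` — the same with all four of `u`, `∇u`,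
  `p`, `f` in `L²_loc(Q)` (`q = q' = 2`);
* `IsDistributionalStokesSolutionOn.local_energy_inequality_holder`,
  `IsDistributionalStokesSolutionOn.local_energy_inequality` — the CKN-shaped inequalities
  (`≤`), i.e. the `localEnergy` clause of `IsSuitableWeakSolutionOn` with `ν = 1` and no cubic
  term, as corollaries.

## Mathlib / tree search

Tree (all used): `IsDistributionalStokesSolutionOn` with `.of_le`, `.mollified_momentum_vec`,
`.divergence_mollified_eq_zero` (`SereginLocalStokesRegularity`, `StokesMollified`);
`HasWeakSpatialGradientOn` with `.mono`, `.fderiv_mollified`, `stMollify`, `zeroExt`,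
`contDiff_uncurry_stMollify` (`SuitableWeak`, `SpaceTimeMollifier`);
`integral_two_mul_inner_eq_of_momentum` (`SmoothLocalEnergy`); `tendsto_setIntegral_mul_bilin`,
`tendsto_setIntegral_clm_bilin`, `integrable_mul_bilin_of_memLp`, `integrable_clm_bilin_of_memLp`
(`MollifiedLimits`); `weights_eq_zero_of_notMem_tsupport`, `memLp_two_of_frobeniusNormSq`,
`memLp_zeroExt` (`NSSuitableESSProofs`, whose `ae_localEnergyInequality_of_L3infty` is the
Navier–Stokes model of this file); `FunctionSpaces.exists_contDiffBump_seq`,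
`FunctionSpaces.tendsto_eLpNorm_normed_convolution_sub_self`,
`UnboundedOperators.memLp_convolution_lsmul`. `lean search 'local_energy|localEnergy'` with
`Stokes`: no local energy statement for the linear Stokes system in the tree (the Navier–Stokes
ones — `NSSuitableESSProofs`, `LocalLerayInitialEnergy*`, `SuitableWeakStability` — carry the
cubic term and stronger integrability hypotheses). Mathlib: `IsCompact.exists_cthickening_subset_open`,
`integral_eq_zero_of_hasDerivAt_of_integrable`, `integral_prod`, `integral_prod_symm`,
`memLp_two_iff_integrable_sq_norm`.

## References

* L. Caffarelli, R. Kohn, L. Nirenberg, *Partial regularity of suitable weak solutions of the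
  Navier–Stokes equations*, CPAM 35 (1982), §2, (2.5) and the remark following it.
  [CaffarelliKohnNirenberg1982]
* L. Escauriaza, G. Seregin, V. Šverák, *`L_{3,∞}`-solutions of Navier–Stokes equations and
  backward uniqueness*, Russ. Math. Surveys 58:2 (2003), proof of Thm. 1.4, first paragraph.
  [EscauriazaSereginSverak2003]
* G. Seregin, *Lecture notes on regularity theory for the Navier–Stokes equations*, World
  Scientific (2014), §4.6, (4.6.1). [Seregin2014]
* Z. Bradshaw, T.-P. Tsai, Ann. Henri Poincaré 18 (2017), proof of Thm. 2.4 ("the approximating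
  solutions `(u_ε, p_ε)` all satisfy the local energy equality"). [BradshawTsai2017AHP]
-/

noncomputable section

open MeasureTheory TopologicalSpace Set Function Filter Topology ContinuousLinearMap Metric
  InnerProductSpace Module
open scoped ENNReal NNReal Convolution RealInnerProductSpace Laplacian ContDiff

namespace Literature.Analysis.FluidPDE

variable {E : Type*} [NormedAddCommGroup E] [InnerProductSpace ℝ E] [FiniteDimensional ℝ E]
  [MeasurableSpace E] [BorelSpace E]

/-! ### The identity for smooth solutions of the forced Stokes system -/

section Smooth

omit [MeasurableSpace E] [BorelSpace E] in
/-- A continuous function on space–time vanishing off the support of a test function is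
integrable (it is continuous with compact support). [folklore] -/
theorem integrable_of_continuous_of_tsupport_spaceTime [MeasurableSpace E] [BorelSpace E]
    {g : ℝ × E → ℝ} {φ : ℝ → E → ℝ} (hg : Continuous g)
    (hφ : HasCompactSupport (uncurry φ)) (h : ∀ z, z ∉ tsupport (uncurry φ) → g z = 0) :
    Integrable g (volume : Measure (ℝ × E)) :=
  hg.integrable_of_hasCompactSupport (HasCompactSupport.intro hφ h)

/-- **The local energy identity for smooth solutions of the forced Stokes system.** Let `V`, `P`
be jointly smooth and `F` jointly continuous on `ℝ × E`, `φ` a space–time test function, and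
assume that on `{φ ≠ 0}` the fields satisfy `∂ₜV - ΔV + ∇P = F`, `div V = 0`. Then
`2 ∫∫ φ |DV|² = ∫∫ (|V|² (∂ₜφ + Δφ) + 2 P ⟪V, ∇φ⟫ + 2 ⟪F, V⟫ φ)`: multiply by `φV`, integrate
by parts in space (the tree's slice identity `integral_two_mul_inner_eq_of_momentum` with `N = 0`
and `W = ∂ₜV - F`), and integrate `∂ₜ(φ|V|²)` along time lines (Caffarelli–Kohn–Nirenberg 1982,
§2, (2.5) "with equality" for smooth solutions, here without the cubic term). [cite: CaffarelliKohnNirenberg1982, §2 (2.5)] -/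
theorem local_energy_identity_smooth_stokes {V F : ℝ → E → E} {P : ℝ → E → ℝ} {φ : ℝ → E → ℝ}
    {Ω : Opens (ℝ × E)}
    (hV : ContDiff ℝ ∞ (uncurry V)) (hF : Continuous (uncurry F))
    (hP : ContDiff ℝ ∞ (uncurry P)) (hφ : IsSpaceTimeTestOn Ω φ)
    (hmom : ∀ s y, φ s y ≠ 0 → timeDeriv V s y - (Δ (V s)) y + gradient (P s) y = F s y)
    (hdiv : ∀ s y, φ s y ≠ 0 → VectorCalculus.divergence (V s) y = 0) :
    2 * ∫ z : ℝ × E, φ z.1 z.2 * frobeniusNormSq (fderiv ℝ (V z.1) z.2) =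
      ∫ z : ℝ × E, (‖V z.1 z.2‖ ^ 2 * (timeDeriv φ z.1 z.2 + (Δ (φ z.1)) z.2) +
        2 * (P z.1 z.2 * ⟪V z.1 z.2, gradient (φ z.1) z.2⟫) +
        2 * (⟪F z.1 z.2, V z.1 z.2⟫ * φ z.1 z.2)) := by
  set b := stdOrthonormalBasis ℝ E with hb
  -- the support of `φ` and the vanishing of the weights off it
  set K : Set (ℝ × E) := tsupport (uncurry φ) with hK_def
  have hKc : HasCompactSupport (uncurry φ) := hφ.hasCompactSupport
  have hw0 : ∀ z, z ∉ K → φ z.1 z.2 = 0 ∧ gradient (φ z.1) z.2 = 0 ∧ (Δ (φ z.1)) z.2 = 0 ∧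
      timeDeriv φ z.1 z.2 = 0 := fun z hz => weights_eq_zero_of_notMem_tsupport hz
  -- joint smoothness and continuity of all the fields involved
  have sV : IsSmoothSpaceTimeOn univ V := hV.contDiffOn
  have sφ : IsSmoothSpaceTimeOn univ φ := hφ.isSmoothSpaceTimeOn univ
  have sP : IsSmoothSpaceTimeOn univ P := hP.contDiffOn
  have sTV : IsSmoothSpaceTimeOn univ (timeDeriv V) := by
    rw [timeDeriv_eq_timeDerivWithin_univ]; exact sV.timeDerivWithin uniqueDiffOn_univ
  have sDV : IsSmoothSpaceTimeOn univ (fun s y => fderiv ℝ (V s) y) :=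
    sV.fderiv_slice uniqueDiffOn_univ
  have sΔφ : IsSmoothSpaceTimeOn univ (fun s y => (Δ (φ s)) y) := sφ.laplacian uniqueDiffOn_univ
  have sgφ : IsSmoothSpaceTimeOn univ (fun s y => gradient (φ s) y) :=
    sφ.gradient uniqueDiffOn_univ
  have cV : Continuous (uncurry V) := hV.continuous
  have cφ : Continuous (uncurry φ) := hφ.contDiff.continuous
  have cP : Continuous (uncurry P) := hP.continuous
  have cTV : Continuous (uncurry (timeDeriv V)) := sTV.continuous_uncurry
  have cDV : Continuous (uncurry fun s y => fderiv ℝ (V s) y) := sDV.continuous_uncurry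
  have cΔφ : Continuous (uncurry fun s y => (Δ (φ s)) y) := sΔφ.continuous_uncurry
  have cgφ : Continuous (uncurry fun s y => gradient (φ s) y) := sgφ.continuous_uncurry
  have cTφ : Continuous (uncurry (timeDeriv φ)) := hφ.continuous_timeDeriv
  -- the integrands
  set A : ℝ × E → ℝ := fun z => 2 * φ z.1 z.2 * ⟪V z.1 z.2, timeDeriv V z.1 z.2 - F z.1 z.2⟫
    with hA
  set D : ℝ × E → ℝ := fun z => timeDeriv φ z.1 z.2 * ‖V z.1 z.2‖ ^ 2 +
    φ z.1 z.2 * (2 * ⟪V z.1 z.2, timeDeriv V z.1 z.2⟫) with hD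
  set T1 : ℝ × E → ℝ := fun z => timeDeriv φ z.1 z.2 * ‖V z.1 z.2‖ ^ 2 with hT1
  set TF : ℝ × E → ℝ := fun z => 2 * (⟪F z.1 z.2, V z.1 z.2⟫ * φ z.1 z.2) with hTF
  set T3 : ℝ × E → ℝ := fun z => ‖V z.1 z.2‖ ^ 2 * (Δ (φ z.1)) z.2 with hT3
  set Gd : ℝ × E → ℝ := fun z => φ z.1 z.2 * frobeniusNormSq (fderiv ℝ (V z.1) z.2) with hGd
  set T5 : ℝ × E → ℝ := fun z => P z.1 z.2 * ⟪V z.1 z.2, gradient (φ z.1) z.2⟫ with hT5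
  -- continuity of the integrands
  have cA : Continuous A := (continuous_const.mul cφ).mul (cV.inner (cTV.sub hF))
  have cT1 : Continuous T1 := cTφ.mul (cV.norm.pow 2)
  have cTF : Continuous TF := continuous_const.mul ((hF.inner cV).mul cφ)
  have cT3 : Continuous T3 := (cV.norm.pow 2).mul cΔφ
  have cGd : Continuous Gd := cφ.mul (LerayHopfProofs.continuous_frobeniusNormSq.comp cDV)
  have cT5 : Continuous T5 := cP.mul (cV.inner cgφ)
  have cD : Continuous D := cT1.add (cφ.mul (continuous_const.mul (cV.inner cTV)))
  -- vanishing of the integrands off `K`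
  have A0 : ∀ z, z ∉ K → A z = 0 := fun z hz => by simp only [hA, (hw0 z hz).1, mul_zero, zero_mul]
  have T10 : ∀ z, z ∉ K → T1 z = 0 := fun z hz => by simp only [hT1, (hw0 z hz).2.2.2, zero_mul]
  have TF0 : ∀ z, z ∉ K → TF z = 0 := fun z hz => by simp only [hTF, (hw0 z hz).1, mul_zero]
  have T30 : ∀ z, z ∉ K → T3 z = 0 := fun z hz => by simp only [hT3, (hw0 z hz).2.2.1, mul_zero]
  have Gd0 : ∀ z, z ∉ K → Gd z = 0 := fun z hz => by simp only [hGd, (hw0 z hz).1, zero_mul]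
  have T50 : ∀ z, z ∉ K → T5 z = 0 := fun z hz => by
    simp only [hT5, (hw0 z hz).2.1, inner_zero_right, mul_zero]
  have D0 : ∀ z, z ∉ K → D z = 0 := fun z hz => by
    simp only [hD, (hw0 z hz).1, (hw0 z hz).2.2.2, zero_mul, add_zero]
  -- integrability on space–time (continuous, supported in `K`)
  have iA : Integrable A (volume : Measure (ℝ × E)) :=
    integrable_of_continuous_of_tsupport_spaceTime cA hKc A0
  have iT1 : Integrable T1 (volume : Measure (ℝ × E)) :=
    integrable_of_continuous_of_tsupport_spaceTime cT1 hKc T10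
  have iTF : Integrable TF (volume : Measure (ℝ × E)) :=
    integrable_of_continuous_of_tsupport_spaceTime cTF hKc TF0
  have iT3 : Integrable T3 (volume : Measure (ℝ × E)) :=
    integrable_of_continuous_of_tsupport_spaceTime cT3 hKc T30
  have iGd : Integrable Gd (volume : Measure (ℝ × E)) :=
    integrable_of_continuous_of_tsupport_spaceTime cGd hKc Gd0
  have iT5 : Integrable T5 (volume : Measure (ℝ × E)) :=
    integrable_of_continuous_of_tsupport_spaceTime cT5 hKc T50
  have iD : Integrable D (volume : Measure (ℝ × E)) :=
    integrable_of_continuous_of_tsupport_spaceTime cD hKc D0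
  -- the same with respect to the product measure
  have hvol : (volume : Measure (ℝ × E)) = (volume : Measure ℝ).prod (volume : Measure E) :=
    Measure.volume_eq_prod _ _
  have iA' : Integrable A ((volume : Measure ℝ).prod (volume : Measure E)) := by rwa [← hvol]
  have iT3' : Integrable T3 ((volume : Measure ℝ).prod (volume : Measure E)) := by rwa [← hvol]
  have iGd' : Integrable Gd ((volume : Measure ℝ).prod (volume : Measure E)) := by rwa [← hvol]
  have iT5' : Integrable T5 ((volume : Measure ℝ).prod (volume : Measure E)) := by rwa [← hvol]
  have iD' : Integrable D ((volume : Measure ℝ).prod (volume : Measure E)) := by rwa [← hvol]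
  -- slices of compactly supported continuous space–time functions are integrable
  set Kx : Set E := Prod.snd '' K with hKx_def
  have hKx : IsCompact Kx := hKc.isCompact.image continuous_snd
  have hKxK : ∀ s y, (s, y) ∈ K → y ∈ Kx := fun s y h => ⟨(s, y), h, rfl⟩
  have islice : ∀ {T : ℝ × E → ℝ}, Continuous T → (∀ z, z ∉ K → T z = 0) → ∀ s,
      Integrable (fun y => T (s, y)) (volume : Measure E) := fun {T} hc h0 s =>
    (hc.comp (Continuous.prodMk_right s)).integrable_of_hasCompactSupport
      (HasCompactSupport.intro hKx fun y hy => h0 (s, y) fun h => hy (hKxK s y h))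
  -- ## Step 1: the slice identity at each time `s`
  have hslice : ∀ s, ∫ y, A (s, y) =
      (∫ y, T3 (s, y)) - 2 * (∫ y, Gd (s, y)) + 2 * ∫ y, T5 (s, y) := by
    intro s
    have hVs : ContDiff ℝ 2 (V s) := (sV.contDiff_slice (mem_univ s)).of_le (by
      change ((2 : ℕ∞) : WithTop ℕ∞) ≤ ((⊤ : ℕ∞) : WithTop ℕ∞); exact_mod_cast le_top)
    have hPs : ContDiff ℝ 1 (P s) := (sP.contDiff_slice (mem_univ s)).of_le (by exact_mod_cast le_top)
    have hφs : ContDiff ℝ 2 (φ s) := (sφ.contDiff_slice (mem_univ s)).of_le (by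
      change ((2 : ℕ∞) : WithTop ℕ∞) ≤ ((⊤ : ℕ∞) : WithTop ℕ∞); exact_mod_cast le_top)
    have hNs : ∀ _i : Fin (finrank ℝ E), ContDiff ℝ 1 (fun _ : E => (0 : E)) := fun _ =>
      contDiff_const
    have hmom' : ∀ y, φ s y ≠ 0 → ∀ i : Fin (finrank ℝ E),
        ⟪timeDeriv V s y - F s y, b i⟫ +
          VectorCalculus.divergence (fun _ : E => (0 : E)) y - 1 * ⟪(Δ (V s)) y, b i⟫ +
          fderiv ℝ (P s) y (b i) = 0 := by
      intro y hy i
      have hm := hmom s y hy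
      have hdiv0 : VectorCalculus.divergence (fun _ : E => (0 : E)) y = 0 := by
        simp [VectorCalculus.divergence]
      have e : timeDeriv V s y - F s y - (Δ (V s)) y + gradient (P s) y = 0 := by
        rw [← hm]; abel
      rw [hdiv0, add_zero, one_mul, ← inner_gradient_left (𝕜 := ℝ) (f := P s), ← inner_sub_left,
        ← inner_add_left, e, inner_zero_left]
    have key := integral_two_mul_inner_eq_of_momentum b (ν := 1) (V := V s)
      (W := fun y => timeDeriv V s y - F s y) (N := fun _ : Fin (finrank ℝ E) => fun _ : E => (0 : E))
      (P := P s) (φ := φ s) hVs hNs hPs hφs (hφ.hasCompactSupport_slice s) hmom'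
      (fun y hy => hdiv s y hy)
    simp only [inner_zero_left, map_zero, zero_mul, mul_zero, add_zero, integral_zero,
      Finset.sum_const_zero, one_mul] at key
    have eA : ∫ y, A (s, y) = ∫ y, 2 * φ s y * ⟪V s y, timeDeriv V s y - F s y⟫ := rfl
    rw [eA, key]
    simp only [hT3, hGd, hT5]
    ring
  -- ## Step 2: integrate the slice identity in time
  have step2 : ∫ z, A z = (∫ z, T3 z) - 2 * (∫ z, Gd z) + 2 * ∫ z, T5 z := by
    rw [hvol, integral_prod A iA', integral_prod T3 iT3', integral_prod Gd iGd',
      integral_prod T5 iT5']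
    have i3 : Integrable (fun s => ∫ y, T3 (s, y)) (volume : Measure ℝ) := iT3'.integral_prod_left
    have iG : Integrable (fun s => ∫ y, Gd (s, y)) (volume : Measure ℝ) := iGd'.integral_prod_left
    have i5 : Integrable (fun s => ∫ y, T5 (s, y)) (volume : Measure ℝ) := iT5'.integral_prod_left
    have iG2 : Integrable (fun s => 2 * ∫ y, Gd (s, y)) (volume : Measure ℝ) := iG.const_mul 2
    have i52 : Integrable (fun s => 2 * ∫ y, T5 (s, y)) (volume : Measure ℝ) := i5.const_mul 2
    have i3G : Integrable (fun s => (∫ y, T3 (s, y)) - 2 * ∫ y, Gd (s, y)) (volume : Measure ℝ) :=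
      i3.sub iG2
    rw [integral_congr_ae (Eventually.of_forall hslice), integral_add i3G i52, integral_sub i3 iG2,
      integral_const_mul, integral_const_mul]
  -- ## Step 3: `∫∫ (∂ₜφ |V|² + 2 φ ⟪V, ∂ₜV⟫) = 0` (fundamental theorem of calculus on time lines)
  have step3 : ∫ z, D z = 0 := by
    rw [hvol, integral_prod_symm D iD']
    refine integral_eq_zero_of_ae (Eventually.of_forall fun y => ?_)
    change ∫ s, D (s, y) = 0
    -- the time line `s ↦ φ s y |V s y|²` and its derivative
    have hderiv : ∀ s, HasDerivAt (fun s => φ s y * ‖V s y‖ ^ 2) (D (s, y)) s := by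
      intro s
      have h1 : HasDerivAt (fun s => V s y) (timeDeriv V s y) s := by
        have := sV.hasDerivAt_timeLine isOpen_univ (mem_univ s) y
        rwa [← timeDeriv_apply] at this
      exact (hφ.hasDerivAt_time s y).mul h1.norm_sq
    -- both are continuous with compact support in time
    obtain ⟨R, hR⟩ := hKc.isCompact.isBounded.subset_closedBall (0 : ℝ × E)
    have hoffR : ∀ s, s ∉ Icc (-R) R → (s, y) ∉ K := fun s hs hmem => by
      have h1 := hR hmem
      rw [mem_closedBall, dist_zero_right, Prod.norm_def] at h1
      have h2 : ‖s‖ ≤ R := (le_max_left _ _).trans h1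
      rw [Real.norm_eq_abs, abs_le] at h2
      exact hs ⟨h2.1, h2.2⟩
    have iDy : Integrable (fun s => D (s, y)) (volume : Measure ℝ) :=
      (cD.comp (Continuous.prodMk_left y)).integrable_of_hasCompactSupport
        (HasCompactSupport.intro isCompact_Icc fun s hs => D0 _ (hoffR s hs))
    have ify : Integrable (fun s => φ s y * ‖V s y‖ ^ 2) (volume : Measure ℝ) := by
      refine ((cφ.comp (Continuous.prodMk_left y)).mul
        ((cV.comp (Continuous.prodMk_left y)).norm.pow 2)).integrable_of_hasCompactSupport
        (HasCompactSupport.intro (K := Icc (-R) R) isCompact_Icc fun s hs => ?_)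
      change φ s y * ‖V s y‖ ^ 2 = 0
      rw [(hw0 _ (hoffR s hs)).1, zero_mul]
    exact integral_eq_zero_of_hasDerivAt_of_integrable hderiv iDy ify
  -- ## Step 4: `∫∫ A = ∫∫ 2φ⟪V, ∂ₜV⟫ - ∫∫ 2φ⟪V, F⟫ = -∫∫ ∂ₜφ|V|² - ∫∫ 2⟪F, V⟫φ`
  have step4 : ∫ z, A z = -(∫ z, T1 z) - ∫ z, TF z := by
    have eA : ∀ z, A z = (D z - T1 z) - TF z := fun z => by
      simp only [hA, hD, hT1, hTF, inner_sub_right, real_inner_comm (F z.1 z.2)]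
      ring
    have iDT : Integrable (fun z => D z - T1 z) (volume : Measure (ℝ × E)) := iD.sub iT1
    rw [integral_congr_ae (Eventually.of_forall eA), integral_sub iDT iTF, integral_sub iD iT1,
      step3, zero_sub]
  -- ## Step 5: assemble
  have hR : ∫ z : ℝ × E, (‖V z.1 z.2‖ ^ 2 * (timeDeriv φ z.1 z.2 + (Δ (φ z.1)) z.2) +
        2 * (P z.1 z.2 * ⟪V z.1 z.2, gradient (φ z.1) z.2⟫) +
        2 * (⟪F z.1 z.2, V z.1 z.2⟫ * φ z.1 z.2)) =
      (∫ z, T1 z) + (∫ z, T3 z) + 2 * (∫ z, T5 z) + ∫ z, TF z := by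
    have e : ∀ z : ℝ × E, (‖V z.1 z.2‖ ^ 2 * (timeDeriv φ z.1 z.2 + (Δ (φ z.1)) z.2) +
        2 * (P z.1 z.2 * ⟪V z.1 z.2, gradient (φ z.1) z.2⟫) +
        2 * (⟪F z.1 z.2, V z.1 z.2⟫ * φ z.1 z.2)) = T1 z + T3 z + 2 * T5 z + TF z := fun z => by
      simp only [hT1, hT3, hT5, hTF]; ring
    have i13 : Integrable (fun z => T1 z + T3 z) (volume : Measure (ℝ × E)) := iT1.add iT3
    have i52 : Integrable (fun z => 2 * T5 z) (volume : Measure (ℝ × E)) := iT5.const_mul 2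
    have i135 : Integrable (fun z => T1 z + T3 z + 2 * T5 z) (volume : Measure (ℝ × E)) :=
      i13.add i52
    rw [integral_congr_ae (Eventually.of_forall e), integral_add i135 iTF, integral_add i13 i52,
      integral_add iT1 iT3, integral_const_mul]
  have hL : 2 * ∫ z : ℝ × E, φ z.1 z.2 * frobeniusNormSq (fderiv ℝ (V z.1) z.2) = 2 * ∫ z, Gd z :=
    rfl
  rw [hR, hL]
  linarith [step2, step4]

end Smooth

/-! ### The local energy equality of `L²_loc` distributional Stokes solutions -/

section Main

variable {Q : Opens (ℝ × E)} {f u : ℝ → E → E} {p : ℝ → E → ℝ} {G : ℝ → E → E →L[ℝ] E}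

set_option maxHeartbeats 800000 in
/-- **The local energy equality for distributional solutions of the forced Stokes system, with
the pressure term controlled by a Hölder pair.** Let `(u, p)` solve `∂ₜu - Δu + ∇p = f`,
`div u = 0` in `𝒟'(Q)` (`IsDistributionalStokesSolutionOn Q f u p`), let `G` be a weak spatial
gradient of `u` on `Q`, assume `|u|²`, `|G|²` (Frobenius) and `|f|²` are integrable on the compact
subsets of `Q`, and, for conjugate exponents `1/q + 1/q' = 1` (`1 ≤ q, q' < ∞`), that
`p ∈ L^q(K)` and `u ∈ L^{q'}(K)` for every compact `K ⊆ Q`. Then for every test function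
`φ ∈ C_c^∞(Q)`,
`2 ∫∫_Q |G|² φ = ∫∫_Q (|u|² (∂ₜφ + Δφ) + 2 p ⟪u, ∇φ⟫ + 2 ⟪f, u⟫ φ)` —
Caffarelli–Kohn–Nirenberg's (2.5) *with equality* and without the cubic term, in the integrability
classes of suitable weak solutions (`q = 3/2`, `q' = 3`: CKN 1982, (2.2)) or of Bradshaw–Tsai's
mollified approximants (`q = 5/3`, `q' = 5/2 ≤ 10/3`), proved by space–time mollification ("the
equations hold for the mollified functions", CKN §2; "usual mollification", ESS 2003, proof of
Thm. 1.4): the mollified triple solves the forced Stokes system pointwise near `supp φ`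
(`StokesMollified`), satisfies `local_energy_identity_smooth_stokes`, and converges in `L²`
together with its gradient and force, the pressure in `L^q` and the velocity also in `L^{q'}`. [cite: CaffarelliKohnNirenberg1982, §2 (2.2), (2.5); EscauriazaSereginSverak2003, proof of Thm. 1.4 (first paragraph)] -/
theorem IsDistributionalStokesSolutionOn.local_energy_equality_holder {q q' : ℝ≥0∞}
    [ENNReal.HolderTriple q q' 1] (hq : 1 ≤ q) (hq' : 1 ≤ q') (hqt : q ≠ ⊤) (hqt' : q' ≠ ⊤)
    (h : IsDistributionalStokesSolutionOn Q f u p) (hG : HasWeakSpatialGradientOn Q u G)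
    (hu2 : LocallyIntegrableOn (fun z : ℝ × E => ‖u z.1 z.2‖ ^ 2) (Q : Set (ℝ × E)) volume)
    (hG2 : LocallyIntegrableOn (fun z : ℝ × E => frobeniusNormSq (G z.1 z.2)) (Q : Set (ℝ × E))
      volume)
    (hpq : ∀ K : Set (ℝ × E), IsCompact K → K ⊆ (Q : Set (ℝ × E)) →
      MemLp (uncurry p) q (volume.restrict K))
    (huq : ∀ K : Set (ℝ × E), IsCompact K → K ⊆ (Q : Set (ℝ × E)) →
      MemLp (uncurry u) q' (volume.restrict K))
    (hf2 : LocallyIntegrableOn (fun z : ℝ × E => ‖f z.1 z.2‖ ^ 2) (Q : Set (ℝ × E)) volume)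
    {φ : ℝ → E → ℝ} (hφ : IsSpaceTimeTestOn Q φ) :
    2 * ∫ z in (Q : Set (ℝ × E)), frobeniusNormSq (G z.1 z.2) * φ z.1 z.2 =
      ∫ z in (Q : Set (ℝ × E)), (‖u z.1 z.2‖ ^ 2 * (timeDeriv φ z.1 z.2 + (Δ (φ z.1)) z.2) +
        2 * (p z.1 z.2 * ⟪u z.1 z.2, gradient (φ z.1) z.2⟫) +
        2 * (⟪f z.1 z.2, u z.1 z.2⟫ * φ z.1 z.2)) := by
  haveI : (volume : Measure (ℝ × E)).IsAddHaarMeasure := Measure.prod.instIsAddHaarMeasure _ _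
  set b := stdOrthonormalBasis ℝ E with hb
  have hQm : MeasurableSet (Q : Set (ℝ × E)) := Q.isOpen.measurableSet
  -- ## (0) the support of `φ`, a margin `δ`, and the localisation `Q₀ = K_δ ⋐ Q`
  set K : Set (ℝ × E) := tsupport (uncurry φ) with hK_def
  have hK : IsCompact K := hφ.hasCompactSupport
  have hKQ : K ⊆ (Q : Set (ℝ × E)) := hφ.tsupport_subset
  obtain ⟨δ, hδ, hδQ⟩ := hK.exists_cthickening_subset_open Q.isOpen hKQ
  set S : Set (ℝ × E) := thickening δ K with hS_def
  set C : Set (ℝ × E) := cthickening δ K with hC_def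
  have hC : IsCompact C := hK.cthickening
  have hSC : S ⊆ C := thickening_subset_cthickening δ K
  have hCQ : C ⊆ (Q : Set (ℝ × E)) := hδQ
  have hSQ : S ⊆ (Q : Set (ℝ × E)) := hSC.trans hCQ
  have hKS : K ⊆ S := self_subset_thickening hδ K
  have hSo : IsOpen S := isOpen_thickening
  have hSm : MeasurableSet S := hSo.measurableSet
  have hSbdd : Bornology.IsBounded S := hK.isBounded.thickening
  set Q₀ : Opens (ℝ × E) := ⟨S, hSo⟩ with hQ₀_def
  have hQ₀S : (Q₀ : Set (ℝ × E)) = S := rfl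
  have hQ₀Q : Q₀ ≤ Q := fun z hz => hSQ hz
  have hballS : ∀ z ∈ K, ∀ r, r < δ → closedBall z r ⊆ (Q₀ : Set (ℝ × E)) := fun z hz r hr =>
    (closedBall_subset_ball hr).trans (ball_subset_thickening hz δ)
  haveI : IsFiniteMeasure (volume.restrict S) := by
    refine ⟨?_⟩
    rw [Measure.restrict_apply_univ]
    exact hSbdd.measure_lt_top
  -- ## (1) the classes of `u`, `G`, `p`, `f` on `S`
  have hum : AEStronglyMeasurable (uncurry u) (volume.restrict S) :=
    h.1.aestronglyMeasurable.mono_measure (Measure.restrict_mono hSQ le_rfl)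
  have hfm : AEStronglyMeasurable (uncurry f) (volume.restrict S) :=
    h.2.2.1.aestronglyMeasurable.mono_measure (Measure.restrict_mono hSQ le_rfl)
  have hGm : AEStronglyMeasurable (uncurry G) (volume.restrict S) :=
    hG.locallyIntegrableOn_grad.aestronglyMeasurable.mono_measure (Measure.restrict_mono hSQ le_rfl)
  have hu2S : MemLp (uncurry u) 2 (volume.restrict S) :=
    (memLp_two_iff_integrable_sq_norm hum).2
      ((hu2.integrableOn_compact_subset hCQ hC).mono_set hSC)
  have hf2S : MemLp (uncurry f) 2 (volume.restrict S) :=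
    (memLp_two_iff_integrable_sq_norm hfm).2
      ((hf2.integrableOn_compact_subset hCQ hC).mono_set hSC)
  have hpqS : MemLp (uncurry p) q (volume.restrict S) :=
    (hpq C hC hCQ).mono_measure (Measure.restrict_mono hSC le_rfl)
  have huqS : MemLp (uncurry u) q' (volume.restrict S) :=
    (huq C hC hCQ).mono_measure (Measure.restrict_mono hSC le_rfl)
  have hG2S : MemLp (uncurry G) 2 (volume.restrict S) := by
    refine memLp_two_of_frobeniusNormSq hGm ?_
    have hi : IntegrableOn (fun z : ℝ × E => frobeniusNormSq (G z.1 z.2)) S volume :=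
      (hG2.integrableOn_compact_subset hCQ hC).mono_set hSC
    refine lt_of_le_of_lt (lintegral_ofReal_le_lintegral_enorm _) hi.2
  -- integrability on `S` (finite measure)
  have huI : IntegrableOn (uncurry u) (Q₀ : Set (ℝ × E)) volume := hu2S.integrable one_le_two
  have hpI : IntegrableOn (uncurry p) (Q₀ : Set (ℝ × E)) volume := hpqS.integrable hq
  have hfI : IntegrableOn (uncurry f) (Q₀ : Set (ℝ × E)) volume := hf2S.integrable one_le_two
  have hGI : IntegrableOn (uncurry G) (Q₀ : Set (ℝ × E)) volume := hG2S.integrable one_le_two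
  -- ## (2) the zero extensions and their whole-space classes
  set ũ : ℝ × E → E := zeroExt Q₀ u with hũ
  set pt : ℝ × E → ℝ := zeroExt Q₀ p with hpt
  set ft : ℝ × E → E := zeroExt Q₀ f with hft
  set Gt : ℝ × E → E →L[ℝ] E := zeroExt Q₀ G with hGt
  have hũ2 : MemLp ũ 2 volume := memLp_zeroExt hQ₀S hSm hu2S
  have hptq : MemLp pt q volume := memLp_zeroExt hQ₀S hSm hpqS
  have hũq : MemLp ũ q' volume := memLp_zeroExt hQ₀S hSm huqS
  have hft2 : MemLp ft 2 volume := memLp_zeroExt hQ₀S hSm hf2S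
  have hGt2 : MemLp Gt 2 volume := memLp_zeroExt hQ₀S hSm hG2S
  have hũi : LocallyIntegrable ũ volume := locallyIntegrable_zeroExt huI
  have hpti : LocallyIntegrable pt volume := locallyIntegrable_zeroExt hpI
  have hfti : LocallyIntegrable ft volume := locallyIntegrable_zeroExt hfI
  have hGti : LocallyIntegrable Gt volume := locallyIntegrable_zeroExt hGI
  -- ## (3) the mollifiers and the mollified fields
  obtain ⟨bump, hbr, -⟩ := FunctionSpaces.exists_contDiffBump_seq (E := ℝ × E)
  set k : ℕ → ℝ × E → ℝ := fun n => (bump n).normed volume with hk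
  have hkinf : ∀ n, ContDiff ℝ (⊤ : ℕ∞) (k n) := fun n => (bump n).contDiff_normed
  have hkr : ∀ n w, w ∉ closedBall (0 : ℝ × E) (bump n).rOut → k n w = 0 := fun n w hw => by
    have : w ∉ Function.support (k n) := by
      rw [hk, (bump n).support_normed_eq]; exact fun h => hw (ball_subset_closedBall h)
    simpa using this
  have hkc : ∀ n, HasCompactSupport (k n) := fun n => (bump n).hasCompactSupport_normed
  set V : ℕ → ℝ → E → E := fun n => stMollify (k n) ũ with hV
  set Pm : ℕ → ℝ → E → ℝ := fun n => stMollify (k n) pt with hPm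
  set Fm : ℕ → ℝ → E → E := fun n => stMollify (k n) ft with hFm
  set Gm : ℕ → ℝ → E → (E →L[ℝ] E) := fun n => stMollify (k n) Gt with hGm
  have hVsm : ∀ n, ContDiff ℝ (⊤ : ℕ∞) (uncurry (V n)) := fun n =>
    contDiff_uncurry_stMollify (hkinf n) (hkc n) hũi
  have hPsm : ∀ n, ContDiff ℝ (⊤ : ℕ∞) (uncurry (Pm n)) := fun n =>
    contDiff_uncurry_stMollify (hkinf n) (hkc n) hpti
  have hFsm : ∀ n, ContDiff ℝ (⊤ : ℕ∞) (uncurry (Fm n)) := fun n =>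
    contDiff_uncurry_stMollify (hkinf n) (hkc n) hfti
  have hGsm : ∀ n, ContDiff ℝ (⊤ : ℕ∞) (uncurry (Gm n)) := fun n =>
    contDiff_uncurry_stMollify (hkinf n) (hkc n) hGti
  -- whole-space convergence and classes of the mollifications
  have cV2 : Tendsto (fun n => eLpNorm (uncurry (V n) - ũ) 2 volume) atTop (𝓝 0) :=
    FunctionSpaces.tendsto_eLpNorm_normed_convolution_sub_self hbr (by norm_num) (by norm_num) hũ2
  have cP : Tendsto (fun n => eLpNorm (uncurry (Pm n) - pt) q volume) atTop (𝓝 0) :=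
    FunctionSpaces.tendsto_eLpNorm_normed_convolution_sub_self hbr hq hqt hptq
  have cVq : Tendsto (fun n => eLpNorm (uncurry (V n) - ũ) q' volume) atTop (𝓝 0) :=
    FunctionSpaces.tendsto_eLpNorm_normed_convolution_sub_self hbr hq' hqt' hũq
  have cF : Tendsto (fun n => eLpNorm (uncurry (Fm n) - ft) 2 volume) atTop (𝓝 0) :=
    FunctionSpaces.tendsto_eLpNorm_normed_convolution_sub_self hbr (by norm_num) (by norm_num) hft2
  have cG : Tendsto (fun n => eLpNorm (uncurry (Gm n) - Gt) 2 volume) atTop (𝓝 0) :=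
    FunctionSpaces.tendsto_eLpNorm_normed_convolution_sub_self hbr (by norm_num) (by norm_num) hGt2
  have mV2 : ∀ n, MemLp (uncurry (V n)) 2 volume := fun n =>
    UnboundedOperators.memLp_convolution_lsmul (bump n).integrable_normed hũ2 (by norm_num)
  have mP : ∀ n, MemLp (uncurry (Pm n)) q volume := fun n =>
    UnboundedOperators.memLp_convolution_lsmul (bump n).integrable_normed hptq hq
  have mVq : ∀ n, MemLp (uncurry (V n)) q' volume := fun n =>
    UnboundedOperators.memLp_convolution_lsmul (bump n).integrable_normed hũq hq'
  have mF : ∀ n, MemLp (uncurry (Fm n)) 2 volume := fun n =>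
    UnboundedOperators.memLp_convolution_lsmul (bump n).integrable_normed hft2 (by norm_num)
  have mG : ∀ n, MemLp (uncurry (Gm n)) 2 volume := fun n =>
    UnboundedOperators.memLp_convolution_lsmul (bump n).integrable_normed hGt2 (by norm_num)
  -- ## (4) the mollified equations on `supp φ` for small radii, and the smooth identity
  have h₀ : IsDistributionalStokesSolutionOn Q₀ f u p := h.of_le hQ₀Q
  have hG₀ : HasWeakSpatialGradientOn Q₀ u G := hG.mono hQ₀Q
  have hEQ : ∀ n, (bump n).rOut < δ → ∀ s y, φ s y ≠ 0 →
      (timeDeriv (V n) s y - (Δ (V n s)) y + gradient (Pm n s) y = Fm n s y) ∧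
      VectorCalculus.divergence (V n s) y = 0 ∧ fderiv ℝ (V n s) y = Gm n s y := by
    intro n hn s y hy
    have hz : (s, y) ∈ K := subset_tsupport _ (by exact hy)
    have hsub : closedBall ((s, y) : ℝ × E) (bump n).rOut ⊆ (Q₀ : Set (ℝ × E)) :=
      hballS _ hz _ hn
    exact ⟨h₀.mollified_momentum_vec huI hpI hfI (hkinf n) (hkr n) hsub,
      h₀.divergence_mollified_eq_zero huI (hkinf n) (hkr n) hsub,
      hG₀.fderiv_mollified huI hGI (hkinf n) (hkr n) hsub⟩
  have hID : ∀ n, (bump n).rOut < δ →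
      2 * ∫ z : ℝ × E, φ z.1 z.2 * frobeniusNormSq (fderiv ℝ (V n z.1) z.2) =
      ∫ z : ℝ × E, (‖V n z.1 z.2‖ ^ 2 * (timeDeriv φ z.1 z.2 + (Δ (φ z.1)) z.2) +
        2 * (Pm n z.1 z.2 * ⟪V n z.1 z.2, gradient (φ z.1) z.2⟫) +
        2 * (⟪Fm n z.1 z.2, V n z.1 z.2⟫ * φ z.1 z.2)) := fun n hn =>
    local_energy_identity_smooth_stokes (hVsm n) (hFsm n).continuous (hPsm n) hφ
      (fun s y hy => (hEQ n hn s y hy).1) (fun s y hy => (hEQ n hn s y hy).2.1)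
  -- ## (5) the weights
  have sφ : IsSmoothSpaceTimeOn univ φ := hφ.isSmoothSpaceTimeOn univ
  have cφ : Continuous (uncurry φ) := hφ.contDiff.continuous
  have cgφ : Continuous (uncurry fun s y => gradient (φ s) y) :=
    (sφ.gradient uniqueDiffOn_univ).continuous_uncurry
  have cΔφ : Continuous (uncurry fun s y => (Δ (φ s)) y) :=
    (sφ.laplacian uniqueDiffOn_univ).continuous_uncurry
  have cTφ : Continuous (uncurry (timeDeriv φ)) := hφ.continuous_timeDeriv
  set wΔ : ℝ × E → ℝ := fun z => timeDeriv φ z.1 z.2 + (Δ (φ z.1)) z.2 with hwΔ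
  set wφ : ℝ × E → ℝ := fun z => φ z.1 z.2 with hwφ
  set wg : ℝ × E → E →L[ℝ] ℝ := fun z => innerSL ℝ (gradient (φ z.1) z.2) with hwg
  have cwΔ : Continuous wΔ := cTφ.add cΔφ
  have cwg : Continuous wg := (innerSL ℝ).continuous.comp cgφ
  have hw0 : ∀ z, z ∉ K → wφ z = 0 ∧ wg z = 0 ∧ wΔ z = 0 := fun z hz => by
    obtain ⟨h1, h2, h3, h4⟩ := weights_eq_zero_of_notMem_tsupport hz
    refine ⟨h1, ?_, ?_⟩
    · simp only [hwg, h2, map_zero]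
    · simp only [hwΔ, h3, h4, add_zero]
  obtain ⟨CΔ, hCΔ⟩ := cwΔ.bounded_above_of_compact_support
    (hφ.hasCompactSupport.mono' fun z hz => by by_contra h'; exact hz (hw0 z h').2.2)
  obtain ⟨Cφ, hCφ⟩ := cφ.bounded_above_of_compact_support hφ.hasCompactSupport
  obtain ⟨Cg, hCg⟩ := cwg.bounded_above_of_compact_support
    (hφ.hasCompactSupport.mono' fun z hz => by by_contra h'; exact hz (hw0 z h').2.1)
  have mwΔ : AEStronglyMeasurable wΔ volume := cwΔ.aestronglyMeasurable
  have mwφ : AEStronglyMeasurable wφ volume := cφ.aestronglyMeasurable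
  have mwg : AEStronglyMeasurable wg volume := cwg.aestronglyMeasurable
  have bwΔ : ∀ᵐ z ∂(volume : Measure (ℝ × E)), ‖wΔ z‖ ≤ CΔ := Eventually.of_forall hCΔ
  have bwφ : ∀ᵐ z ∂(volume : Measure (ℝ × E)), ‖wφ z‖ ≤ Cφ := Eventually.of_forall hCφ
  have bwg : ∀ᵐ z ∂(volume : Measure (ℝ × E)), ‖wg z‖ ≤ Cg := Eventually.of_forall hCg
  -- the bilinear forms
  set βI : E →L[ℝ] E →L[ℝ] ℝ := innerSL ℝ with hβI
  set βF : Fin (finrank ℝ E) → (E →L[ℝ] E) →L[ℝ] (E →L[ℝ] E) →L[ℝ] ℝ := fun i =>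
    (innerSL ℝ).bilinearComp (ContinuousLinearMap.apply ℝ E (b i))
      (ContinuousLinearMap.apply ℝ E (b i)) with hβF
  set βs : ℝ →L[ℝ] E →L[ℝ] E := ContinuousLinearMap.lsmul ℝ ℝ with hβs
  have βF_apply : ∀ i (L L' : E →L[ℝ] E), βF i L L' = ⟪L (b i), L' (b i)⟫ := fun i L L' => by
    simp [hβF]
  have βI_apply : ∀ x y : E, βI x y = ⟪x, y⟫ := fun x y => rfl
  have βs_apply : ∀ (a : ℝ) (x : E), βs a x = a • x := fun a x => rfl
  have wg_apply : ∀ (z : ℝ × E) (x : E), wg z x = ⟪gradient (φ z.1) z.2, x⟫ := fun z x => rfl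
  haveI hHT22 : ENNReal.HolderTriple 2 2 1 := ENNReal.HolderConjugate.instTwoTwo
  -- ## (6) the limits, term by term
  have limL : ∀ i, Tendsto (fun n => ∫ z in univ, wφ z * βF i (uncurry (Gm n) z) (uncurry (Gm n) z))
      atTop (𝓝 (∫ z in univ, wφ z * βF i (Gt z) (Gt z))) := fun i =>
    tendsto_setIntegral_mul_bilin (p := 2) (q := 2) one_le_two (βF i) mG hGt2 mG hGt2 cG cG mwφ
      bwφ univ
  have limT1 : Tendsto (fun n => ∫ z in univ, wΔ z * βI (uncurry (V n) z) (uncurry (V n) z))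
      atTop (𝓝 (∫ z in univ, wΔ z * βI (ũ z) (ũ z))) :=
    tendsto_setIntegral_mul_bilin (p := 2) (q := 2) one_le_two βI mV2 hũ2 mV2 hũ2 cV2 cV2 mwΔ
      bwΔ univ
  have limT5 : Tendsto (fun n => ∫ z in univ, wg z (βs (uncurry (Pm n) z) (uncurry (V n) z)))
      atTop (𝓝 (∫ z in univ, wg z (βs (pt z) (ũ z)))) :=
    tendsto_setIntegral_clm_bilin (p := q) (q := q') hq' βs mP hptq mVq hũq cP cVq mwg
      bwg univ
  have limTF : Tendsto (fun n => ∫ z in univ, wφ z * βI (uncurry (Fm n) z) (uncurry (V n) z))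
      atTop (𝓝 (∫ z in univ, wφ z * βI (ft z) (ũ z))) :=
    tendsto_setIntegral_mul_bilin (p := 2) (q := 2) one_le_two βI mF hft2 mV2 hũ2 cF cV2 mwφ
      bwφ univ
  -- ## (7) the identities in `T`-form for small radii
  have hEQK : ∀ n, (bump n).rOut < δ → ∀ s y, (s, y) ∈ K →
      fderiv ℝ (V n s) y = Gm n s y := by
    intro n hn s y hz
    have hsub : closedBall ((s, y) : ℝ × E) (bump n).rOut ⊆ (Q₀ : Set (ℝ × E)) :=
      hballS _ hz _ hn
    exact hG₀.fderiv_mollified huI hGI (hkinf n) (hkr n) hsub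
  have pwL : ∀ n, (bump n).rOut < δ → ∀ z : ℝ × E,
      φ z.1 z.2 * frobeniusNormSq (fderiv ℝ (V n z.1) z.2) =
        ∑ i, wφ z * βF i (uncurry (Gm n) z) (uncurry (Gm n) z) := by
    intro n hn z
    by_cases hzs : z ∈ K
    · rw [hEQK n hn z.1 z.2 hzs, frobeniusNormSq_eq_sum b, Finset.mul_sum]
      refine Finset.sum_congr rfl fun i _ => ?_
      rw [βF_apply, real_inner_self_eq_norm_sq]; rfl
    · have h0 := (hw0 z hzs).1
      simp only [hwφ] at h0 ⊢
      simp [h0]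
  have pwR : ∀ n (z : ℝ × E),
      (‖V n z.1 z.2‖ ^ 2 * (timeDeriv φ z.1 z.2 + (Δ (φ z.1)) z.2) +
        2 * (Pm n z.1 z.2 * ⟪V n z.1 z.2, gradient (φ z.1) z.2⟫) +
        2 * (⟪Fm n z.1 z.2, V n z.1 z.2⟫ * φ z.1 z.2)) =
      wΔ z * βI (uncurry (V n) z) (uncurry (V n) z) +
        2 * wg z (βs (uncurry (Pm n) z) (uncurry (V n) z)) +
        2 * (wφ z * βI (uncurry (Fm n) z) (uncurry (V n) z)) := by
    intro n z
    simp only [βI_apply, βs_apply, wg_apply, hwΔ, hwφ, uncurry, real_inner_smul_right,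
      real_inner_self_eq_norm_sq, real_inner_comm (V n z.1 z.2) (gradient (φ z.1) z.2)]
    ring
  -- integrability of the pieces
  have iL : ∀ n i, Integrable (fun z => wφ z * βF i (uncurry (Gm n) z) (uncurry (Gm n) z))
      (volume : Measure (ℝ × E)) := fun n i =>
    integrable_mul_bilin_of_memLp (p := 2) (q := 2) _ (mG n) (mG n) mwφ bwφ
  have iT1 : ∀ n, Integrable (fun z => wΔ z * βI (uncurry (V n) z) (uncurry (V n) z))
      (volume : Measure (ℝ × E)) := fun n =>
    integrable_mul_bilin_of_memLp (p := 2) (q := 2) _ (mV2 n) (mV2 n) mwΔ bwΔ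
  have iT5 : ∀ n, Integrable (fun z => wg z (βs (uncurry (Pm n) z) (uncurry (V n) z)))
      (volume : Measure (ℝ × E)) := fun n =>
    integrable_clm_bilin_of_memLp (p := q) (q := q') _ (mP n) (mVq n) mwg bwg
  have iTF : ∀ n, Integrable (fun z => wφ z * βI (uncurry (Fm n) z) (uncurry (V n) z))
      (volume : Measure (ℝ × E)) := fun n =>
    integrable_mul_bilin_of_memLp (p := 2) (q := 2) _ (mF n) (mV2 n) mwφ bwφ
  have hIDT : ∀ n, (bump n).rOut < δ →
      2 * ∑ i, ∫ z in univ, wφ z * βF i (uncurry (Gm n) z) (uncurry (Gm n) z) =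
      (∫ z in univ, wΔ z * βI (uncurry (V n) z) (uncurry (V n) z)) +
        2 * (∫ z in univ, wg z (βs (uncurry (Pm n) z) (uncurry (V n) z))) +
        2 * ∫ z in univ, wφ z * βI (uncurry (Fm n) z) (uncurry (V n) z) := by
    intro n hn
    have h := hID n hn
    have j2 : Integrable (fun z => 2 * wg z (βs (uncurry (Pm n) z) (uncurry (V n) z)))
        (volume : Measure (ℝ × E)) := (iT5 n).const_mul 2
    have j3 : Integrable (fun z => 2 * (wφ z * βI (uncurry (Fm n) z) (uncurry (V n) z)))
        (volume : Measure (ℝ × E)) := (iTF n).const_mul 2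
    have j12 : Integrable (fun z => wΔ z * βI (uncurry (V n) z) (uncurry (V n) z) +
        2 * wg z (βs (uncurry (Pm n) z) (uncurry (V n) z))) (volume : Measure (ℝ × E)) :=
      (iT1 n).add j2
    rw [integral_congr_ae (Eventually.of_forall (pwL n hn)),
      integral_finsetSum _ (fun i _ => iL n i), integral_congr_ae (Eventually.of_forall (pwR n)),
      integral_add j12 j3, integral_add (iT1 n) j2, integral_const_mul, integral_const_mul] at h
    simp only [Measure.restrict_univ]
    exact h
  -- ## (8) the limit identity
  have hev : ∀ᶠ n in atTop, (bump n).rOut < δ := (tendsto_order.1 hbr).2 δ hδ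
  have I1 : 2 * ∑ i, ∫ z in univ, wφ z * βF i (Gt z) (Gt z) =
      (∫ z in univ, wΔ z * βI (ũ z) (ũ z)) + 2 * (∫ z in univ, wg z (βs (pt z) (ũ z))) +
        2 * ∫ z in univ, wφ z * βI (ft z) (ũ z) :=
    tendsto_nhds_unique_of_eventuallyEq ((tendsto_finsetSum _ fun i _ => limL i).const_mul _)
      ((limT1.add (limT5.const_mul _)).add (limTF.const_mul _)) (hev.mono fun n hn => hIDT n hn)
  -- ## (9) identification of the limits
  have hũu : ∀ z ∈ S, ũ z = u z.1 z.2 := fun z hz => zeroExt_of_mem _ hz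
  have hptp : ∀ z ∈ S, pt z = p z.1 z.2 := fun z hz => zeroExt_of_mem _ hz
  have hftf : ∀ z ∈ S, ft z = f z.1 z.2 := fun z hz => zeroExt_of_mem _ hz
  have hGtG : ∀ z ∈ S, Gt z = G z.1 z.2 := fun z hz => zeroExt_of_mem _ hz
  have hKof : ∀ z, z ∉ S → z ∉ K := fun z hz h' => hz (hKS h')
  -- from whole-space integrals to integrals over `Q` for integrands vanishing off `K`
  have hrestr : ∀ {g : ℝ × E → ℝ}, (∀ z, z ∉ K → g z = 0) →
      ∫ z in univ, g z = ∫ z in (Q : Set (ℝ × E)), g z := fun {g} hg => by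
    rw [Measure.restrict_univ]
    exact (setIntegral_eq_integral_of_forall_compl_eq_zero fun z hz => hg z fun h' => hz (hKQ h')).symm
  -- pointwise identification on `Q`
  have eL : ∀ z ∈ (Q : Set (ℝ × E)), (∑ i, wφ z * βF i (Gt z) (Gt z)) =
      frobeniusNormSq (G z.1 z.2) * φ z.1 z.2 := by
    intro z _
    by_cases hzS : z ∈ S
    · rw [hGtG z hzS, frobeniusNormSq_eq_sum b, Finset.sum_mul]
      refine Finset.sum_congr rfl fun i _ => ?_
      rw [βF_apply, real_inner_self_eq_norm_sq, mul_comm]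
    · have h0 := (hw0 z (hKof z hzS)).1
      simp only [hwφ] at h0 ⊢
      simp [h0]
  have eT1 : ∀ z ∈ (Q : Set (ℝ × E)), wΔ z * βI (ũ z) (ũ z) =
      ‖u z.1 z.2‖ ^ 2 * (timeDeriv φ z.1 z.2 + (Δ (φ z.1)) z.2) := by
    intro z _
    by_cases hzS : z ∈ S
    · rw [βI_apply, real_inner_self_eq_norm_sq, hũu z hzS, mul_comm]
    · have h0 := (hw0 z (hKof z hzS)).2.2
      simp only [hwΔ] at h0 ⊢
      rw [h0, zero_mul, mul_zero]
  have eT5 : ∀ z ∈ (Q : Set (ℝ × E)), wg z (βs (pt z) (ũ z)) =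
      p z.1 z.2 * ⟪u z.1 z.2, gradient (φ z.1) z.2⟫ := by
    intro z _
    by_cases hzS : z ∈ S
    · rw [wg_apply, βs_apply, real_inner_smul_right, hũu z hzS, hptp z hzS, real_inner_comm]
    · have h0 := (hw0 z (hKof z hzS)).2.1
      have hg' : gradient (φ z.1) z.2 = 0 :=
        (weights_eq_zero_of_notMem_tsupport (hKof z hzS)).2.1
      rw [h0, hg', inner_zero_right, mul_zero, _root_.zero_apply]
  have eTF : ∀ z ∈ (Q : Set (ℝ × E)), wφ z * βI (ft z) (ũ z) =
      ⟪f z.1 z.2, u z.1 z.2⟫ * φ z.1 z.2 := by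
    intro z _
    by_cases hzS : z ∈ S
    · rw [βI_apply, hũu z hzS, hftf z hzS, mul_comm]
    · have h0 := (hw0 z (hKof z hzS)).1
      simp only [hwφ] at h0 ⊢
      rw [h0, zero_mul, mul_zero]
  -- global integrability of the limit integrands
  have iLinf : ∀ i, Integrable (fun z => wφ z * βF i (Gt z) (Gt z)) (volume : Measure (ℝ × E)) :=
    fun i => integrable_mul_bilin_of_memLp (p := 2) (q := 2) _ hGt2 hGt2 mwφ bwφ
  have iT1inf : Integrable (fun z => wΔ z * βI (ũ z) (ũ z)) (volume : Measure (ℝ × E)) :=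
    integrable_mul_bilin_of_memLp (p := 2) (q := 2) _ hũ2 hũ2 mwΔ bwΔ
  have iT5inf : Integrable (fun z => wg z (βs (pt z) (ũ z))) (volume : Measure (ℝ × E)) :=
    integrable_clm_bilin_of_memLp (p := q) (q := q') _ hptq hũq mwg bwg
  have iTFinf : Integrable (fun z => wφ z * βI (ft z) (ũ z)) (volume : Measure (ℝ × E)) :=
    integrable_mul_bilin_of_memLp (p := 2) (q := 2) _ hft2 hũ2 mwφ bwφ
  -- vanishing off `K` of the limit integrands
  have vL : ∀ z, z ∉ K → (∑ i, wφ z * βF i (Gt z) (Gt z)) = 0 := fun z hz => by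
    have h0 := (hw0 z hz).1
    simp only [hwφ] at h0 ⊢
    simp [h0]
  have vT1 : ∀ z, z ∉ K → wΔ z * βI (ũ z) (ũ z) = 0 := fun z hz => by
    rw [(hw0 z hz).2.2, zero_mul]
  have vT5 : ∀ z, z ∉ K → wg z (βs (pt z) (ũ z)) = 0 := fun z hz => by
    rw [(hw0 z hz).2.1, _root_.zero_apply]
  have vTF : ∀ z, z ∉ K → wφ z * βI (ft z) (ũ z) = 0 := fun z hz => by
    have h0 := (hw0 z hz).1
    simp only [hwφ] at h0 ⊢
    rw [h0, zero_mul]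
  -- the four identifications
  have cL : ∑ i, ∫ z in univ, wφ z * βF i (Gt z) (Gt z) =
      ∫ z in (Q : Set (ℝ × E)), frobeniusNormSq (G z.1 z.2) * φ z.1 z.2 := by
    rw [← integral_finsetSum _ fun i _ => (iLinf i).integrableOn, hrestr vL]
    exact setIntegral_congr_fun hQm eL
  have cT1 : ∫ z in univ, wΔ z * βI (ũ z) (ũ z) =
      ∫ z in (Q : Set (ℝ × E)), ‖u z.1 z.2‖ ^ 2 * (timeDeriv φ z.1 z.2 + (Δ (φ z.1)) z.2) := by
    rw [hrestr vT1]
    exact setIntegral_congr_fun hQm eT1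
  have cT5 : ∫ z in univ, wg z (βs (pt z) (ũ z)) =
      ∫ z in (Q : Set (ℝ × E)), p z.1 z.2 * ⟪u z.1 z.2, gradient (φ z.1) z.2⟫ := by
    rw [hrestr vT5]
    exact setIntegral_congr_fun hQm eT5
  have cTF : ∫ z in univ, wφ z * βI (ft z) (ũ z) =
      ∫ z in (Q : Set (ℝ × E)), ⟪f z.1 z.2, u z.1 z.2⟫ * φ z.1 z.2 := by
    rw [hrestr vTF]
    exact setIntegral_congr_fun hQm eTF
  -- integrability of the target integrands on `Q`
  have jT1 : IntegrableOn (fun z : ℝ × E => ‖u z.1 z.2‖ ^ 2 * (timeDeriv φ z.1 z.2 + (Δ (φ z.1)) z.2))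
      (Q : Set (ℝ × E)) volume := iT1inf.integrableOn.congr_fun eT1 hQm
  have jT5 : IntegrableOn (fun z : ℝ × E => p z.1 z.2 * ⟪u z.1 z.2, gradient (φ z.1) z.2⟫)
      (Q : Set (ℝ × E)) volume := iT5inf.integrableOn.congr_fun eT5 hQm
  have jTF : IntegrableOn (fun z : ℝ × E => ⟪f z.1 z.2, u z.1 z.2⟫ * φ z.1 z.2)
      (Q : Set (ℝ × E)) volume := iTFinf.integrableOn.congr_fun eTF hQm
  -- the target right-hand side, split
  have hRHS : ∫ z in (Q : Set (ℝ × E)), (‖u z.1 z.2‖ ^ 2 * (timeDeriv φ z.1 z.2 + (Δ (φ z.1)) z.2) +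
        2 * (p z.1 z.2 * ⟪u z.1 z.2, gradient (φ z.1) z.2⟫) +
        2 * (⟪f z.1 z.2, u z.1 z.2⟫ * φ z.1 z.2)) =
      (∫ z in (Q : Set (ℝ × E)), ‖u z.1 z.2‖ ^ 2 * (timeDeriv φ z.1 z.2 + (Δ (φ z.1)) z.2)) +
        2 * (∫ z in (Q : Set (ℝ × E)), p z.1 z.2 * ⟪u z.1 z.2, gradient (φ z.1) z.2⟫) +
        2 * ∫ z in (Q : Set (ℝ × E)), ⟪f z.1 z.2, u z.1 z.2⟫ * φ z.1 z.2 := by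
    have j2 : IntegrableOn (fun z : ℝ × E => 2 * (p z.1 z.2 * ⟪u z.1 z.2, gradient (φ z.1) z.2⟫))
        (Q : Set (ℝ × E)) volume := jT5.const_mul 2
    have j3 : IntegrableOn (fun z : ℝ × E => 2 * (⟪f z.1 z.2, u z.1 z.2⟫ * φ z.1 z.2))
        (Q : Set (ℝ × E)) volume := jTF.const_mul 2
    have j12 : IntegrableOn (fun z : ℝ × E => ‖u z.1 z.2‖ ^ 2 * (timeDeriv φ z.1 z.2 + (Δ (φ z.1)) z.2) +
        2 * (p z.1 z.2 * ⟪u z.1 z.2, gradient (φ z.1) z.2⟫)) (Q : Set (ℝ × E)) volume := jT1.add j2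
    rw [integral_add j12 j3, integral_add jT1 j2, integral_const_mul, integral_const_mul]
  rw [hRHS, ← cL, ← cT1, ← cT5, ← cTF]
  exact I1

/-- On a compact `K ⊆ Q`, local square integrability of `|g|²` on `Q` gives `g ∈ L²(K)`. [folklore] -/
theorem memLp_two_restrict_of_locallyIntegrableOn_sq {F : Type*} [NormedAddCommGroup F]
    {g : ℝ → E → F} (hgm : AEStronglyMeasurable (uncurry g) (volume.restrict (Q : Set (ℝ × E))))
    (hg2 : LocallyIntegrableOn (fun z : ℝ × E => ‖g z.1 z.2‖ ^ 2) (Q : Set (ℝ × E)) volume)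
    {K : Set (ℝ × E)} (hK : IsCompact K) (hKQ : K ⊆ (Q : Set (ℝ × E))) :
    MemLp (uncurry g) 2 (volume.restrict K) :=
  (memLp_two_iff_integrable_sq_norm (hgm.mono_measure (Measure.restrict_mono hKQ le_rfl))).2
    (hg2.integrableOn_compact_subset hKQ hK)

/-- **The local energy equality for `L²_loc` distributional solutions of the forced Stokes
system.** Let `(u, p)` solve `∂ₜu - Δu + ∇p = f`, `div u = 0` in `𝒟'(Q)`
(`IsDistributionalStokesSolutionOn Q f u p`), let `G` be a weak spatial gradient of `u` on `Q`,
and assume `|u|²`, `|G|²` (Frobenius), `p²` and `|f|²` are integrable on the compact subsets of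
`Q`. Then for every test function `φ ∈ C_c^∞(Q)`,
`2 ∫∫_Q |G|² φ = ∫∫_Q (|u|² (∂ₜφ + Δφ) + 2 p ⟪u, ∇φ⟫ + 2 ⟪f, u⟫ φ)` —
Caffarelli–Kohn–Nirenberg's (2.5) *with equality* and without the cubic term
(`local_energy_equality_holder` with `q = q' = 2`). [cite: CaffarelliKohnNirenberg1982, §2 (2.5); EscauriazaSereginSverak2003, proof of Thm. 1.4 (first paragraph)] -/
theorem IsDistributionalStokesSolutionOn.local_energy_equality
    (h : IsDistributionalStokesSolutionOn Q f u p) (hG : HasWeakSpatialGradientOn Q u G)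
    (hu2 : LocallyIntegrableOn (fun z : ℝ × E => ‖u z.1 z.2‖ ^ 2) (Q : Set (ℝ × E)) volume)
    (hG2 : LocallyIntegrableOn (fun z : ℝ × E => frobeniusNormSq (G z.1 z.2)) (Q : Set (ℝ × E))
      volume)
    (hp2 : LocallyIntegrableOn (fun z : ℝ × E => p z.1 z.2 ^ 2) (Q : Set (ℝ × E)) volume)
    (hf2 : LocallyIntegrableOn (fun z : ℝ × E => ‖f z.1 z.2‖ ^ 2) (Q : Set (ℝ × E)) volume)
    {φ : ℝ → E → ℝ} (hφ : IsSpaceTimeTestOn Q φ) :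
    2 * ∫ z in (Q : Set (ℝ × E)), frobeniusNormSq (G z.1 z.2) * φ z.1 z.2 =
      ∫ z in (Q : Set (ℝ × E)), (‖u z.1 z.2‖ ^ 2 * (timeDeriv φ z.1 z.2 + (Δ (φ z.1)) z.2) +
        2 * (p z.1 z.2 * ⟪u z.1 z.2, gradient (φ z.1) z.2⟫) +
        2 * (⟪f z.1 z.2, u z.1 z.2⟫ * φ z.1 z.2)) := by
  haveI : ENNReal.HolderTriple 2 2 1 := ENNReal.HolderConjugate.instTwoTwo
  have hpK : ∀ K : Set (ℝ × E), IsCompact K → K ⊆ (Q : Set (ℝ × E)) →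
      MemLp (uncurry p) 2 (volume.restrict K) := fun K hK hKQ => by
    have hpm : AEStronglyMeasurable (uncurry p) (volume.restrict K) :=
      h.2.1.aestronglyMeasurable.mono_measure (Measure.restrict_mono hKQ le_rfl)
    refine (memLp_two_iff_integrable_sq_norm hpm).2 ?_
    refine (hp2.integrableOn_compact_subset hKQ hK).congr_fun (fun z _ => ?_) hK.measurableSet
    change p z.1 z.2 ^ 2 = ‖p z.1 z.2‖ ^ 2
    rw [Real.norm_eq_abs, sq_abs]
  exact h.local_energy_equality_holder (q := 2) (q' := 2) one_le_two one_le_two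
    ENNReal.ofNat_ne_top ENNReal.ofNat_ne_top hG hu2 hG2 hpK
    (fun K hK hKQ => memLp_two_restrict_of_locallyIntegrableOn_sq h.1.aestronglyMeasurable
      hu2 hK hKQ) hf2 hφ

/-- **The local energy inequality of distributional Stokes solutions, Hölder-pair form**
(CKN-shaped corollary, `ν = 1`, no cubic term): under the hypotheses of
`local_energy_equality_holder`, for every test function `φ ∈ C_c^∞(Q)`,
`2 ∫∫_Q |G|² φ ≤ ∫∫_Q (|u|² (∂ₜφ + Δφ) + 2 p ⟪u, ∇φ⟫ + 2 ⟪f, u⟫ φ)` — the `localEnergy` clause of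
`IsSuitableWeakSolutionOn` for the linear system (Caffarelli–Kohn–Nirenberg 1982, §2, (2.5)). [cite: CaffarelliKohnNirenberg1982, §2 (2.5)] -/
theorem IsDistributionalStokesSolutionOn.local_energy_inequality_holder {q q' : ℝ≥0∞}
    [ENNReal.HolderTriple q q' 1] (hq : 1 ≤ q) (hq' : 1 ≤ q') (hqt : q ≠ ⊤) (hqt' : q' ≠ ⊤)
    (h : IsDistributionalStokesSolutionOn Q f u p) (hG : HasWeakSpatialGradientOn Q u G)
    (hu2 : LocallyIntegrableOn (fun z : ℝ × E => ‖u z.1 z.2‖ ^ 2) (Q : Set (ℝ × E)) volume)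
    (hG2 : LocallyIntegrableOn (fun z : ℝ × E => frobeniusNormSq (G z.1 z.2)) (Q : Set (ℝ × E))
      volume)
    (hpq : ∀ K : Set (ℝ × E), IsCompact K → K ⊆ (Q : Set (ℝ × E)) →
      MemLp (uncurry p) q (volume.restrict K))
    (huq : ∀ K : Set (ℝ × E), IsCompact K → K ⊆ (Q : Set (ℝ × E)) →
      MemLp (uncurry u) q' (volume.restrict K))
    (hf2 : LocallyIntegrableOn (fun z : ℝ × E => ‖f z.1 z.2‖ ^ 2) (Q : Set (ℝ × E)) volume)
    {φ : ℝ → E → ℝ} (hφ : IsSpaceTimeTestOn Q φ) :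
    2 * ∫ z in (Q : Set (ℝ × E)), frobeniusNormSq (G z.1 z.2) * φ z.1 z.2 ≤
      ∫ z in (Q : Set (ℝ × E)), (‖u z.1 z.2‖ ^ 2 * (timeDeriv φ z.1 z.2 + (Δ (φ z.1)) z.2) +
        2 * (p z.1 z.2 * ⟪u z.1 z.2, gradient (φ z.1) z.2⟫) +
        2 * (⟪f z.1 z.2, u z.1 z.2⟫ * φ z.1 z.2)) :=
  (h.local_energy_equality_holder hq hq' hqt hqt' hG hu2 hG2 hpq huq hf2 hφ).le

/-- **The local energy inequality of `L²_loc` distributional Stokes solutions** (CKN-shaped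
corollary, `ν = 1`, no cubic term): under the hypotheses of `local_energy_equality`, for every
nonnegative test function `φ ∈ C_c^∞(Q)`,
`2 ∫∫_Q |G|² φ ≤ ∫∫_Q (|u|² (∂ₜφ + Δφ) + 2 p ⟪u, ∇φ⟫ + 2 ⟪f, u⟫ φ)` — the `localEnergy` clause of
`IsSuitableWeakSolutionOn` for the linear system (Caffarelli–Kohn–Nirenberg 1982, §2, (2.5)). [cite: CaffarelliKohnNirenberg1982, §2 (2.5)] -/
theorem IsDistributionalStokesSolutionOn.local_energy_inequality
    (h : IsDistributionalStokesSolutionOn Q f u p) (hG : HasWeakSpatialGradientOn Q u G)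
    (hu2 : LocallyIntegrableOn (fun z : ℝ × E => ‖u z.1 z.2‖ ^ 2) (Q : Set (ℝ × E)) volume)
    (hG2 : LocallyIntegrableOn (fun z : ℝ × E => frobeniusNormSq (G z.1 z.2)) (Q : Set (ℝ × E))
      volume)
    (hp2 : LocallyIntegrableOn (fun z : ℝ × E => p z.1 z.2 ^ 2) (Q : Set (ℝ × E)) volume)
    (hf2 : LocallyIntegrableOn (fun z : ℝ × E => ‖f z.1 z.2‖ ^ 2) (Q : Set (ℝ × E)) volume)
    {φ : ℝ → E → ℝ} (hφ : IsSpaceTimeTestOn Q φ) :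
    2 * ∫ z in (Q : Set (ℝ × E)), frobeniusNormSq (G z.1 z.2) * φ z.1 z.2 ≤
      ∫ z in (Q : Set (ℝ × E)), (‖u z.1 z.2‖ ^ 2 * (timeDeriv φ z.1 z.2 + (Δ (φ z.1)) z.2) +
        2 * (p z.1 z.2 * ⟪u z.1 z.2, gradient (φ z.1) z.2⟫) +
        2 * (⟪f z.1 z.2, u z.1 z.2⟫ * φ z.1 z.2)) :=
  (h.local_energy_equality hG hu2 hG2 hp2 hf2 hφ).le

end Main

end Literature.Analysis.FluidPDE
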